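import Literature.Computability.Complexity.CountingHierarchy
import Literature.Computability.Complexity.SpaceProofs
import Literature.Computability.Complexity.OrbitDeciderStepper
import Literature.Computability.Complexity.OrbitDecidersExists
import Literature.Computability.Complexity.MajorityEnumeration
import HarnessLib

/-!
# `CH ⊆ PSPACE` (Bürgisser, ECCC TR06-113, §2.1) — proof file; orbit deciders are closed under the majority quantifier

Sibling proof file of `CountingHierarchy.lean` (D-0014): the discharge `CH_subset_PSPACE_holds` of the
named fact `CH_subset_PSPACE` — Wagner's counting hierarchy `CH = ⋃ₖ CₖP`, `C₀P = P`,
`Cₖ₊₁P = C'·CₖP` (the majority operator `pMajority`), is contained in `PSPACE` (Bürgisser, ECCC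
TR06-113, §2.1, p. 5: "it is not hard to see that CH is contained in the class PSPACE of languages
decidable in polynomial space"; Wagner 1986). No proof is printed; the standard one is the induction
`CₖP ⊆ PSPACE`, whose step is the closure of `PSPACE` under the majority quantifier,

  `C'·PSPACE ⊆ PSPACE`  (`pMajority_PSPACE_subset_PSPACE`),

proved exactly like Gill's `PP ⊆ PSPACE` (Gill 1977, Prop. 5.2(i); the tree's
`MajorityEnumeration.lean` / `SpaceProofs.lean`): run through the coin strings `y ∈ {0,1}^{p(|x|)}`
one after the other, reusing the space of one decision of `⟨x, y⟩ ∈ L'`, and count. Here the decision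
of `L' ∈ PSPACE` is itself an exponentially long orbit of an `FP` function — an ORBIT DECIDER
(`OrbitDeciders.lean`; every `PSPACE` language has one, `orbitDecider_of_mem_PSPACE`,
`OrbitDeciderStepper.lean`) —, so the machine-free part of the argument is

* **G3** `OrbitDecider.pMajority D p` — orbit deciders are closed under the majority quantifier: from
  an orbit decider `D` of `A` and a polynomial `p`, an orbit decider of
  `{x | 2^{p(|x|)} < 2 · #{y ∈ {0,1}^{p(|x|)} | ⟨x, y⟩ ∈ A}}`. It is the twin of G2
  (`OrbitDecider.polyExists`, `OrbitDecidersExists.lean`, closure under `∃ᵖ`), with the OR of the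
  verdicts replaced by Gill's counter: the state `a ⟨x, ⟨y, ⟨K, ⟨c, st⟩⟩⟩⟩` holds the answer bit, the
  input, the current coin string, the binary count `K`, the binary round counter `c` of the inner
  orbit and its current state `st`; the coin strings `0^m, …, 1^m` (`m = p(|x|)`) are the block
  `natBits m 0, …, natBits m (2^m - 1)` of the shortlex enumeration `PolyExistsEnum.cand`
  (`cand (2^m - 1 + i) = natBits m i`, `PolyExistsEnumeration.lean`), stepped by the successor
  `Exists.sxFn`; after `1^m` comes `0^{m+1}`, too long, and the state freezes. For each coin string the
  inner orbit is restarted on `⟨x, y⟩` and run for exactly `2^{|Nu ⟨x,y⟩|}` rounds; then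
  `K ← K + [verdict]` (`Brick.addFn`) and `a ← [m < |K|]`. The count starts at `2^{m-1} - 1` (numeral
  `1^{m-1}`, the padding of Arora–Barak 2009, Lemma 17.7, as in `PPEnum.initFn`), so that `K` and `a`
  after `i` coin strings are literally `PPEnum.counter A p x i` and `PPEnum.ansBit A p x i` of
  `MajorityEnumeration.lean`, whose arithmetic (`PPEnum.ansBit_two_pow`: the final answer bit is
  `[2^m < 2 · cnt]`; `PPEnum.length_counter_le`) is reused;
* `mem_PSPACE_pMajority_of_orbitDecider`, **`pMajority_PSPACE_subset_PSPACE`** (`C'·PSPACE ⊆ PSPACE`),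
  `pMajority_PSPACE_eq` (`C'·PSPACE = PSPACE`);
* `CkP_subset_PSPACE` (`CₖP ⊆ PSPACE`, induction from `P_subset_PSPACE_holds` with `pMajority_mono`),
  **`CH_subset_PSPACE_holds`**, and the restatement `PP_subset_PSPACE_of_CH` (`PP = C₁P`).

## References

* P. Bürgisser, *On defining integers in the counting hierarchy and proving lower bounds in algebraic
  complexity*, ECCC TR06-113 (2006), §2.1 (Def. 2.1–2.3, p. 4; `PH ⊆ CH ⊆ PSPACE`, p. 5); journal
  version Comput. Complexity 18 (2009) 81–103. [Burgisser2006]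
* K. W. Wagner, *The complexity of combinatorial problems with succinct input representation*, Acta
  Inform. 23 (1986) 325–356. [Wagner1986]
* J. Gill, *Computational complexity of probabilistic Turing machines*, SIAM J. Comput. 6 (1977),
  Prop. 5.2(i) and its proof (`PP ⊆ PSPACE` by enumerating the coin sequences in the space of one
  run). [Gill1977]
* S. Arora, B. Barak, *Computational Complexity: A Modern Approach*, CUP 2009, Thm. 4.2 and §4.1
  (space-bounded computation, reuse of space), Lemma 17.7 (padding the count). [AroraBarakCC2009]
-/

noncomputable section

namespace Literature.Computability.Complexity

open _root_.Computability Polynomial Brick CoinEnum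
open PolyExistsEnum (next cand cand_succ cand_two_pow_add)

namespace OrbitDecider

variable {A : Language Bool}

namespace Majority

open OrbitDecider.Exists (sxFn sxFn_apply sxFn_mem_FP length_cand_le length_cand_last length_next_le)

/-! ### The block of coin strings of length `m` inside the shortlex enumeration -/

/-- The `i`-th coin string of length `m`, `i < 2^m`, sits at index `2^m - 1 + i` of the shortlex
enumeration and has length `m` (`cand_two_pow_add`). [folklore] -/
theorem length_cand_block {m i : ℕ} (hi : i < 2 ^ m) : (cand (2 ^ m - 1 + i)).length = m := by
  rw [cand_two_pow_add m i hi, length_natBits]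

/-- After the block of length `m` comes index `2^{m+1} - 1`. [folklore] -/
theorem two_pow_sub_one_add_two_pow (m : ℕ) : 2 ^ m - 1 + 2 ^ m = 2 ^ (m + 1) - 1 := by
  have := Nat.one_le_two_pow (n := m)
  rw [pow_succ]
  omega

/-- The string after the block of length `m` has length `m + 1` (it is `0^{m+1}`). [folklore] -/
theorem length_cand_block_end (m : ℕ) : (cand (2 ^ m - 1 + 2 ^ m)).length = m + 1 := by
  rw [two_pow_sub_one_add_two_pow, length_cand_last]

/-- Inside and at the end of the block the strings have length `≤ m + 1`. [folklore] -/
theorem length_cand_block_le {m i : ℕ} (hi : i ≤ 2 ^ m) : (cand (2 ^ m - 1 + i)).length ≤ m + 1 := by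
  refine length_cand_le ?_
  have h1 := Nat.one_le_two_pow (n := m)
  have h2 : 2 ^ (m + 1 + 1) = 2 ^ m * 2 * 2 := by rw [pow_succ, pow_succ]
  omega

/-! ### States -/

/-- The state `a ⟨x, ⟨y, ⟨K, ⟨c, st⟩⟩⟩⟩`: answer bit, input, current coin string, binary count (padded by
`2^{m-1} - 1`), binary round counter of the inner orbit, current state of the inner orbit.
[cite: Gill1977, Prop. 5.2(i) (proof: enumerate the coin sequences, reusing space, and count)] -/
def mk (a : Bool) (x y K c st : List Bool) : List Bool :=
  a :: boolPair x (boolPair y (boolPair K (boolPair c st)))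

/-- Length of a state. [folklore] -/
theorem length_mk (a : Bool) (x y K c st : List Bool) :
    (mk a x y K c st).length = 2 * x.length + 2 * y.length + 2 * K.length + 2 * c.length + st.length + 9 := by
  simp only [mk, length_boolPair, List.length_cons]; ring

/-- The head symbol of a state is its answer bit. [folklore] -/
@[simp] theorem headI_mk (a : Bool) (x y K c st : List Bool) : (mk a x y K c st).headI = a := rfl
/-- The first symbol of a state, as a one-bit string. [folklore] -/
@[simp] theorem take1Fn_mk (a : Bool) (x y K c st : List Bool) : take1Fn (mk a x y K c st) = [a] := rfl

/-- Accessor: the input. [folklore] -/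
def xM : List Bool → List Bool := fstF ∘ List.tail
/-- Accessor: the coin string. [folklore] -/
def yM : List Bool → List Bool := nthF 1 ∘ List.tail
/-- Accessor: the count. [folklore] -/
def kM : List Bool → List Bool := nthF 2 ∘ List.tail
/-- Accessor: the round counter. [folklore] -/
def cM : List Bool → List Bool := nthF 3 ∘ List.tail
/-- Accessor: the inner state. [folklore] -/
def stM : List Bool → List Bool := sndPow 3 ∘ List.tail
/-- Accessor: the pair `⟨x, y⟩`. [folklore] -/
def xyM : List Bool → List Bool := fanoutFn xM yM

/-- `xM` on a state. [folklore] -/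
@[simp] theorem xM_mk (a : Bool) (x y K c st : List Bool) : xM (mk a x y K c st) = x := by simp [xM, mk]
/-- `yM` on a state. [folklore] -/
@[simp] theorem yM_mk (a : Bool) (x y K c st : List Bool) : yM (mk a x y K c st) = y := by simp [yM, mk]
/-- `kM` on a state. [folklore] -/
@[simp] theorem kM_mk (a : Bool) (x y K c st : List Bool) : kM (mk a x y K c st) = K := by simp [kM, mk]
/-- `cM` on a state. [folklore] -/
@[simp] theorem cM_mk (a : Bool) (x y K c st : List Bool) : cM (mk a x y K c st) = c := by simp [cM, mk]
/-- `stM` on a state. [folklore] -/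
@[simp] theorem stM_mk (a : Bool) (x y K c st : List Bool) : stM (mk a x y K c st) = st := by simp [stM, mk]
/-- `xyM` on a state. [folklore] -/
@[simp] theorem xyM_mk (a : Bool) (x y K c st : List Bool) : xyM (mk a x y K c st) = boolPair x y := by
  simp [xyM]

/-- `xM ∈ FP`. [folklore] -/
theorem xM_mem_FP : xM ∈ FP := comp_mem_FP fstF_mem_FP PRelSigma.tail_mem_FP
/-- `yM ∈ FP`. [folklore] -/
theorem yM_mem_FP : yM ∈ FP := comp_mem_FP (nthF_mem_FP 1) PRelSigma.tail_mem_FP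
/-- `kM ∈ FP`. [folklore] -/
theorem kM_mem_FP : kM ∈ FP := comp_mem_FP (nthF_mem_FP 2) PRelSigma.tail_mem_FP
/-- `cM ∈ FP`. [folklore] -/
theorem cM_mem_FP : cM ∈ FP := comp_mem_FP (nthF_mem_FP 3) PRelSigma.tail_mem_FP
/-- `stM ∈ FP`. [folklore] -/
theorem stM_mem_FP : stM ∈ FP := comp_mem_FP (sndPow_mem_FP 3) PRelSigma.tail_mem_FP
/-- `xyM ∈ FP`. [folklore] -/
theorem xyM_mem_FP : xyM ∈ FP := fanoutFn_mem_FP xM_mem_FP yM_mem_FP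

/-! ### The round function -/

section Round

variable (D : OrbitDecider A) (p : Polynomial ℕ)

/-- **Inner round**: step the inner orbit and the round counter,
`a ⟨x,y,K,c,st⟩ ↦ a ⟨x,y,K,c+1,F st⟩`. [folklore] -/
def innerStep : List Bool → List Bool := fun w =>
  take1Fn w ++ fanoutFn xM (fanoutFn yM (fanoutFn kM
    (fanoutFn (addFn ∘ fanoutFn cM (fun _ => [true])) (D.F ∘ stM)))) w

/-- The new count `K + [head st]` in canonical binary (`Brick.addFn`). [cite: Gill1977, Prop. 5.2(i) (proof: count the accepting coin sequences)] -/
def kNew : List Bool → List Bool := addFn ∘ fanoutFn kM (headBitFn stM)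

/-- The new answer bit `[p(|x|) < |K'|]` for the new count `K'` (negated length test `lenLeFn`); for
the padded canonical counts of the orbit this is the majority test. [cite: AroraBarakCC2009, Lemma 17.7 (padding the count)] -/
def aNew : List Bool → List Bool := notFn (lenLeFn p ∘ fanoutFn xM kNew)

/-- **Next coin string**: add the verdict to the count, recompute the answer bit, move to the next
string, restart the inner orbit:
`a ⟨x,y,K,c,st⟩ ↦ [p(|x|) < |K'|] ⟨x, next y, K', ε, ι ⟨x, next y⟩⟩`, `K' = K + [head st]`.
[cite: Gill1977, Prop. 5.2(i) (proof)] -/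
def nextStep : List Bool → List Bool := fun w =>
  aNew p w ++ fanoutFn xM (fanoutFn (sxFn ∘ yM) (fanoutFn kNew
    (fanoutFn (fun _ => []) (D.ι ∘ fanoutFn xM (sxFn ∘ yM))))) w

/-- **The round function**: idle once `|y| > p(|x|)`; otherwise an inner round while the round
counter is below `2^{|Nu ⟨x,y⟩|}` (length test `|c| ≤ |Nu ⟨x,y⟩|`), else the next coin string.
[cite: Gill1977, Prop. 5.2(i) (proof)] -/
def roundM : List Bool → List Bool :=
  iteFn (lenLeFn p ∘ xyM)
    (iteFn (lenLeFn X ∘ fanoutFn (D.Nu ∘ xyM) cM) (innerStep D) (nextStep D p)) id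

/-- The first coin string `0^{p(|x|)}` of input `x`. [folklore] -/
def zerosM : List Bool → List Bool := Kannan.zerosFn ∘ Plumb.polyFn p

/-- The initial count `1^{p(|x|) - 1}`, the numeral of `2^{p(|x|)-1} - 1`. [cite: AroraBarakCC2009, Lemma 17.7] -/
def k0M : List Bool → List Bool := Plumb.dropFn ∘ fanoutFn (fun _ => [true]) (Plumb.polyFn p)

/-- **The initial state** `0 ⟨x, ⟨0^m, ⟨1^{m-1}, ⟨ε, ι ⟨x, 0^m⟩⟩⟩⟩⟩`, `m = p(|x|)`. [folklore] -/
def initM : List Bool → List Bool :=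
  List.cons false ∘ fanoutFn id (fanoutFn (zerosM p) (fanoutFn (k0M p)
    (fanoutFn (fun _ => []) (D.ι ∘ fanoutFn id (zerosM p)))))

/-- **The budget exponent** `1^{m + s(2n+2+m) + 2}`, `m = p(n)` (enough rounds for `2^m` coin strings
of `≤ 2^{s(|⟨x,y⟩|)} + 1` rounds each). [folklore] -/
def NuM : List Bool → List Bool := Plumb.polyFn (p + D.s.comp (2 * X + 2 + p) + 2)

/-- `innerStep` on a state. [folklore] -/
theorem innerStep_mk (a : Bool) (x y K c st : List Bool) :
    innerStep D (mk a x y K c st) = mk a x y K (encodeNat (bitsToNat c + 1)) (D.F st) := by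
  rw [innerStep, take1Fn_mk]
  simp only [fanoutFn_apply, xM_mk, yM_mk, kM_mk, cM_mk, stM_mk, Function.comp_apply, addFn_boolPair,
    show bitsToNat [true] = 1 from rfl]
  rfl

/-- `kNew` on a state. [folklore] -/
@[simp] theorem kNew_mk (a : Bool) (x y K c st : List Bool) :
    kNew (mk a x y K c st) = encodeNat (bitsToNat K + st.headI.toNat) := by
  rw [kNew, Function.comp_apply, fanoutFn_apply, kM_mk, headBitFn_apply, stM_mk, addFn_boolPair]
  cases st.headI <;> rfl

/-- `aNew` on a state. [folklore] -/
theorem aNew_mk (a : Bool) (x y K c st : List Bool) :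
    aNew p (mk a x y K c st) = [decide (p.eval x.length < (encodeNat (bitsToNat K + st.headI.toNat)).length)] := by
  have h : (lenLeFn p ∘ fanoutFn xM kNew) (mk a x y K c st) =
      [decide ((encodeNat (bitsToNat K + st.headI.toNat)).length ≤ p.eval x.length)] := by
    rw [Function.comp_apply, fanoutFn_apply, xM_mk, kNew_mk, lenLeFn_boolPair]
  rw [aNew, notFn_apply h]
  by_cases hc : (encodeNat (bitsToNat K + st.headI.toNat)).length ≤ p.eval x.length
  · rw [decide_eq_true hc, decide_eq_false (Nat.not_lt.2 hc)]; rfl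
  · rw [decide_eq_false hc, decide_eq_true (Nat.lt_of_not_le hc)]; rfl

/-- `nextStep` on a state. [folklore] -/
theorem nextStep_mk (a : Bool) (x y K c st : List Bool) :
    nextStep D p (mk a x y K c st) =
      mk (decide (p.eval x.length < (encodeNat (bitsToNat K + st.headI.toNat)).length)) x (next y)
        (encodeNat (bitsToNat K + st.headI.toNat)) [] (D.ι (boolPair x (next y))) := by
  rw [nextStep, aNew_mk]
  simp only [fanoutFn_apply, xM_mk, yM_mk, kNew_mk, Function.comp_apply, sxFn_apply]
  rfl

/-- `initM` on an input. [folklore] -/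
theorem initM_apply (x : List Bool) :
    initM D p x = mk false x (natBits (p.eval x.length) 0) (ones (p.eval x.length - 1)) []
      (D.ι (boolPair x (natBits (p.eval x.length) 0))) := by
  simp [initM, zerosM, k0M, mk, natBits_zero, ones, List.drop_replicate]

/-- The round on a state whose coin string is too long: nothing happens. [folklore] -/
theorem roundM_mk_of_lt (a : Bool) (x y K c st : List Bool) (hy : p.eval x.length < y.length) :
    roundM D p (mk a x y K c st) = mk a x y K c st := by
  rw [roundM, iteFn_apply_false (by
    rw [Function.comp_apply, xyM_mk, lenLeFn_boolPair, decide_eq_false (Nat.not_le.2 hy)])]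
  rfl

/-- The round on a state with a live coin string and a small counter: an inner round. [folklore] -/
theorem roundM_mk_inner (a : Bool) (x y K c st : List Bool) (hy : y.length ≤ p.eval x.length)
    (hc : c.length ≤ (D.Nu (boolPair x y)).length) :
    roundM D p (mk a x y K c st) = mk a x y K (encodeNat (bitsToNat c + 1)) (D.F st) := by
  rw [roundM, iteFn_apply_true (by rw [Function.comp_apply, xyM_mk, lenLeFn_boolPair, decide_eq_true hy]),
    iteFn_apply_true (by
      rw [Function.comp_apply, fanoutFn_apply, Function.comp_apply, xyM_mk, cM_mk, lenLeFn_boolPair, eval_X,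
        decide_eq_true hc]),
    innerStep_mk]

/-- The round on a state with a live coin string and a full counter: the next coin string. [folklore] -/
theorem roundM_mk_next (a : Bool) (x y K c st : List Bool) (hy : y.length ≤ p.eval x.length)
    (hc : (D.Nu (boolPair x y)).length < c.length) :
    roundM D p (mk a x y K c st) =
      mk (decide (p.eval x.length < (encodeNat (bitsToNat K + st.headI.toNat)).length)) x (next y)
        (encodeNat (bitsToNat K + st.headI.toNat)) [] (D.ι (boolPair x (next y))) := by
  rw [roundM, iteFn_apply_true (by rw [Function.comp_apply, xyM_mk, lenLeFn_boolPair, decide_eq_true hy]),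
    iteFn_apply_false (by
      rw [Function.comp_apply, fanoutFn_apply, Function.comp_apply, xyM_mk, cM_mk, lenLeFn_boolPair, eval_X,
        decide_eq_false (Nat.not_le.2 hc)]),
    nextStep_mk]

/-- `innerStep ∈ FP`. [cite: AroraBarakCC2009, §1.3 (closure under composition)] -/
theorem innerStep_mem_FP : innerStep D ∈ FP :=
  append_mem_FP take1Fn_mem_FP (fanoutFn_mem_FP xM_mem_FP (fanoutFn_mem_FP yM_mem_FP (fanoutFn_mem_FP kM_mem_FP
    (fanoutFn_mem_FP (comp_mem_FP addFn_mem_FP (fanoutFn_mem_FP cM_mem_FP (const_mem_FP _)))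
      (comp_mem_FP D.F_mem stM_mem_FP)))))

/-- `kNew ∈ FP`. [cite: AroraBarakCC2009, §1.3] -/
theorem kNew_mem_FP : kNew ∈ FP :=
  comp_mem_FP addFn_mem_FP (fanoutFn_mem_FP kM_mem_FP (headBitFn_mem_FP stM_mem_FP))

/-- `aNew ∈ FP`. [cite: AroraBarakCC2009, §1.3] -/
theorem aNew_mem_FP : aNew p ∈ FP :=
  notFn_mem_FP (comp_mem_FP (lenLeFn_mem_FP p) (fanoutFn_mem_FP xM_mem_FP kNew_mem_FP))

/-- `nextStep ∈ FP`. [cite: AroraBarakCC2009, §1.3] -/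
theorem nextStep_mem_FP : nextStep D p ∈ FP :=
  append_mem_FP (aNew_mem_FP p)
    (fanoutFn_mem_FP xM_mem_FP (fanoutFn_mem_FP (comp_mem_FP sxFn_mem_FP yM_mem_FP)
      (fanoutFn_mem_FP kNew_mem_FP (fanoutFn_mem_FP (const_mem_FP _) (comp_mem_FP D.ι_mem
        (fanoutFn_mem_FP xM_mem_FP (comp_mem_FP sxFn_mem_FP yM_mem_FP)))))))

/-- `roundM ∈ FP`. [cite: AroraBarakCC2009, §1.3] -/
theorem roundM_mem_FP : roundM D p ∈ FP :=
  iteFn_mem_FP (comp_mem_FP (lenLeFn_mem_FP p) xyM_mem_FP)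
    (iteFn_mem_FP (comp_mem_FP (lenLeFn_mem_FP X) (fanoutFn_mem_FP (comp_mem_FP D.Nu_mem xyM_mem_FP) cM_mem_FP))
      (innerStep_mem_FP D) (nextStep_mem_FP D p))
    OracleCompose.id_mem_FP

/-- `zerosM ∈ FP`. [cite: AroraBarakCC2009, §1.3] -/
theorem zerosM_mem_FP : zerosM p ∈ FP := comp_mem_FP Kannan.zerosFn_mem_FP (Plumb.polyFn_mem_FP p)

/-- `k0M ∈ FP`. [cite: AroraBarakCC2009, §1.3] -/
theorem k0M_mem_FP : k0M p ∈ FP :=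
  comp_mem_FP Plumb.dropFn_mem_FP (fanoutFn_mem_FP (const_mem_FP _) (Plumb.polyFn_mem_FP p))

/-- `initM ∈ FP`. [cite: AroraBarakCC2009, §1.3] -/
theorem initM_mem_FP : initM D p ∈ FP :=
  comp_mem_FP (cons_mem_FP false) (fanoutFn_mem_FP OracleCompose.id_mem_FP (fanoutFn_mem_FP (zerosM_mem_FP p)
    (fanoutFn_mem_FP (k0M_mem_FP p) (fanoutFn_mem_FP (const_mem_FP _)
      (comp_mem_FP D.ι_mem (fanoutFn_mem_FP OracleCompose.id_mem_FP (zerosM_mem_FP p)))))))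

/-- `NuM ∈ FP`. [cite: AroraBarakCC2009, §1.3] -/
theorem NuM_mem_FP : NuM D p ∈ FP := Plumb.polyFn_mem_FP _

/-! ### The trajectory -/

/-- The exponent of the number of inner rounds for the coin string `y`. [folklore] -/
def N (x y : List Bool) : ℕ := (D.Nu (boolPair x y)).length

/-- The verdict of the inner orbit on `⟨x, y⟩`. [folklore] -/
def v (x y : List Bool) : Bool := (D.F^[2 ^ N D x y] (D.ι (boolPair x y))).headI

/-- The verdict is the indicator of `A`. [folklore] -/
theorem v_eq_boolIndicator (x y : List Bool) : v D x y = A.boolIndicator (boolPair x y) := by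
  rcases Bool.eq_false_or_eq_true (A.boolIndicator (boolPair x y)) with h | h
  · rw [h]; exact (D.correct _).2 ((Set.mem_iff_boolIndicator _ _).2 h)
  · rw [h]
    cases hv : v D x y
    · rfl
    · exact absurd ((Set.mem_iff_boolIndicator _ _).1 ((D.correct _).1 hv)) (by rw [h]; simp)

/-- **Inner phase**: from the start of a live coin string `y`, `r ≤ 2^N` rounds advance the inner orbit
and the round counter exactly. [cite: Gill1977, Prop. 5.2(i) (proof: one simulation in polynomial space)] -/
theorem iterate_roundM_inner (a : Bool) (x y K : List Bool) (hy : y.length ≤ p.eval x.length) {r : ℕ}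
    (hr : r ≤ 2 ^ N D x y) :
    (roundM D p)^[r] (mk a x y K [] (D.ι (boolPair x y))) =
      mk a x y K (encodeNat r) (D.F^[r] (D.ι (boolPair x y))) := by
  induction r with
  | zero => rfl
  | succ r ih =>
    rw [Function.iterate_succ_apply', ih (Nat.le_of_succ_le hr), roundM_mk_inner D p a x y K _ _ hy (by
      rw [TM2Pass.length_encodeNat_eq_size, Nat.size_le]; exact hr), bitsToNat_encodeNat,
      Function.iterate_succ_apply']

/-- **Phase transition**: after the inner phase one more round moves to the next coin string, adding
the verdict to the count. [cite: Gill1977, Prop. 5.2(i) (proof)] -/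
theorem iterate_roundM_phase (a : Bool) (x y K : List Bool) (hy : y.length ≤ p.eval x.length) :
    (roundM D p)^[2 ^ N D x y + 1] (mk a x y K [] (D.ι (boolPair x y))) =
      mk (decide (p.eval x.length < (encodeNat (bitsToNat K + (v D x y).toNat)).length)) x (next y)
        (encodeNat (bitsToNat K + (v D x y).toNat)) [] (D.ι (boolPair x (next y))) := by
  rw [Function.iterate_succ_apply', iterate_roundM_inner D p a x y K hy le_rfl,
    roundM_mk_next D p _ x y _ _ _ hy (by rw [TM2Pass.length_encodeNat_eq_size, Nat.lt_size]; rfl)]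
  rfl

/-- The start time of coin string number `i`. [folklore] -/
def S (x : List Bool) (i : ℕ) : ℕ :=
  ∑ i' ∈ Finset.range i, (2 ^ N D x (cand (2 ^ p.eval x.length - 1 + i')) + 1)

/-- The padded count after `i` coin strings is `PPEnum.counter A p x i`; adding the verdict of the
`i`-th gives the next one. [cite: AroraBarakCC2009, Lemma 17.7] -/
theorem counter_succ (x : List Bool) {i : ℕ} (hi : i < 2 ^ p.eval x.length) :
    encodeNat (bitsToNat (PPEnum.counter A p x i) + (v D x (cand (2 ^ p.eval x.length - 1 + i))).toNat) =
      PPEnum.counter A p x (i + 1) := by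
  rw [PPEnum.counter, PPEnum.counter, bitsToNat_encodeNat, PPEnum.acc_succ, cand_two_pow_add _ _ hi,
    v_eq_boolIndicator, Nat.add_assoc]

/-- The initial padded count is the numeral `1^{m-1}` of `2^{m-1} - 1`. [cite: AroraBarakCC2009, Lemma 17.7] -/
theorem counter_zero (x : List Bool) : PPEnum.counter A p x 0 = ones (p.eval x.length - 1) := by
  simp only [PPEnum.counter, PPEnum.acc, Finset.range_zero, Finset.sum_empty, Nat.add_zero,
    encodeNat_two_pow_sub_one]

/-- The initial answer bit is `0`. [folklore] -/
theorem ansBit_zero (x : List Bool) : PPEnum.ansBit A p x 0 = false := by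
  rw [PPEnum.ansBit, counter_zero, decide_eq_false]
  simp only [ones, List.length_replicate]
  omega

/-- **The outer trajectory**: at the start of coin string `i ≤ 2^m` the state holds the answer bit
`PPEnum.ansBit A p x i`, the `i`-th string of the block, the padded count `PPEnum.counter A p x i`, a
zero round counter and a fresh inner orbit. [cite: Gill1977, Prop. 5.2(i) (proof)] -/
theorem iterate_roundM_S (x : List Bool) {i : ℕ} (hi : i ≤ 2 ^ p.eval x.length) :
    (roundM D p)^[S D p x i] (initM D p x) =
      mk (PPEnum.ansBit A p x i) x (cand (2 ^ p.eval x.length - 1 + i)) (PPEnum.counter A p x i) []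
        (D.ι (boolPair x (cand (2 ^ p.eval x.length - 1 + i)))) := by
  induction i with
  | zero =>
    rw [S, Finset.sum_range_zero, Function.iterate_zero, id, initM_apply, ansBit_zero, counter_zero,
      cand_two_pow_add _ 0 (Nat.two_pow_pos _)]
  | succ i ih =>
    have hi' : i < 2 ^ p.eval x.length := hi
    rw [S, Finset.sum_range_succ, ← S, Nat.add_comm, Function.iterate_add_apply, ih hi'.le,
      iterate_roundM_phase D p _ x _ _ (length_cand_block hi').le, counter_succ D p x hi', ← Nat.add_assoc,
      cand_succ]
    rfl

/-- After the last coin string the state is frozen. [folklore] -/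
theorem iterate_roundM_frozen (x : List Bool) (a : Bool) (K st : List Bool) (t : ℕ) :
    (roundM D p)^[t] (mk a x (cand (2 ^ p.eval x.length - 1 + 2 ^ p.eval x.length)) K [] st) =
      mk a x (cand (2 ^ p.eval x.length - 1 + 2 ^ p.eval x.length)) K [] st := by
  induction t with
  | zero => rfl
  | succ t ih =>
    rw [Function.iterate_succ_apply', ih, roundM_mk_of_lt D p _ x _ _ _ _ (by rw [length_cand_block_end]; omega)]

/-- **The total number of rounds** is at most `2^{m + s(2n+2+m) + 2}`. [folklore] -/
theorem S_last_le (x : List Bool) :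
    S D p x (2 ^ p.eval x.length) ≤ 2 ^ (p.eval x.length + D.s.eval (2 * x.length + 2 + p.eval x.length) + 2) := by
  set m := p.eval x.length with hm
  have hterm : ∀ i' ∈ Finset.range (2 ^ m),
      2 ^ N D x (cand (2 ^ m - 1 + i')) + 1 ≤ 2 ^ (D.s.eval (2 * x.length + 2 + m) + 1) := by
    intro i' hi'
    rw [Finset.mem_range] at hi'
    have h1 : N D x (cand (2 ^ m - 1 + i')) ≤ D.s.eval (2 * x.length + 2 + m) := by
      refine (D.Nu_le _).trans (TM2Iter.eval_mono D.s ?_)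
      rw [length_boolPair, length_cand_block hi']
    have h2 := Nat.pow_le_pow_right (show 0 < 2 by norm_num) h1
    have h3 := Nat.one_le_two_pow (n := D.s.eval (2 * x.length + 2 + m))
    rw [pow_succ]; omega
  refine (Finset.sum_le_sum hterm).trans ?_
  rw [Finset.sum_const, Finset.card_range, smul_eq_mul, ← pow_add]
  exact Nat.pow_le_pow_right (by norm_num) (by omega)

/-! ### The shape invariant and the size of the states -/

/-- **Shape invariant**: every state reachable from `initM x` is, for some `i ≤ 2^m` and
`r ≤ 2^{N ⟨x,yᵢ⟩}`, the state `mk a x yᵢ (counter i) (bin r) (F^[r] (ι ⟨x,yᵢ⟩))` with `yᵢ` the `i`-th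
string of the block. [folklore] -/
def Shape (x w : List Bool) : Prop :=
  ∃ (a : Bool) (i r : ℕ), i ≤ 2 ^ p.eval x.length ∧ r ≤ 2 ^ N D x (cand (2 ^ p.eval x.length - 1 + i)) ∧
    w = mk a x (cand (2 ^ p.eval x.length - 1 + i)) (PPEnum.counter A p x i) (encodeNat r)
      (D.F^[r] (D.ι (boolPair x (cand (2 ^ p.eval x.length - 1 + i)))))

/-- The initial state has the shape. [folklore] -/
theorem shape_initM (x : List Bool) : Shape D p x (initM D p x) :=
  ⟨false, 0, 0, Nat.zero_le _, Nat.zero_le _, by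
    rw [initM_apply, counter_zero, cand_two_pow_add _ 0 (Nat.two_pow_pos _)]; rfl⟩

/-- The round function preserves the shape. [folklore] -/
theorem shape_roundM {x w : List Bool} (h : Shape D p x w) : Shape D p x (roundM D p w) := by
  obtain ⟨a, i, r, hi, hr, rfl⟩ := h
  by_cases hlive : (cand (2 ^ p.eval x.length - 1 + i)).length ≤ p.eval x.length
  · have hi' : i < 2 ^ p.eval x.length := by
      refine Nat.lt_of_le_of_ne hi fun h => ?_
      rw [h, length_cand_block_end] at hlive
      omega
    by_cases hc : (encodeNat r).length ≤ N D x (cand (2 ^ p.eval x.length - 1 + i))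
    · refine ⟨a, i, r + 1, hi, ?_, ?_⟩
      · rw [TM2Pass.length_encodeNat_eq_size, Nat.size_le] at hc; exact hc
      · rw [roundM_mk_inner D p a x _ _ _ _ hlive hc, bitsToNat_encodeNat, Function.iterate_succ_apply']
    · have hlt : N D x (cand (2 ^ p.eval x.length - 1 + i)) < (encodeNat r).length := Nat.lt_of_not_le hc
      have hr' : r = 2 ^ N D x (cand (2 ^ p.eval x.length - 1 + i)) := by
        refine le_antisymm hr ?_
        have h := hlt
        rw [TM2Pass.length_encodeNat_eq_size, Nat.lt_size] at h
        exact h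
      refine ⟨PPEnum.ansBit A p x (i + 1), i + 1, 0, hi', Nat.zero_le _, ?_⟩
      rw [roundM_mk_next D p a x _ _ _ _ hlive hlt, hr']
      change mk (decide (p.eval x.length < (encodeNat (bitsToNat (PPEnum.counter A p x i) +
          (v D x (cand (2 ^ p.eval x.length - 1 + i))).toNat)).length)) x (next (cand (2 ^ p.eval x.length - 1 + i)))
        (encodeNat (bitsToNat (PPEnum.counter A p x i) + (v D x (cand (2 ^ p.eval x.length - 1 + i))).toNat)) []
        (D.ι (boolPair x (next (cand (2 ^ p.eval x.length - 1 + i))))) = _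
      rw [counter_succ D p x hi', ← Nat.add_assoc, cand_succ]
      rfl
  · exact ⟨a, i, r, hi, hr, by rw [roundM_mk_of_lt D p a x _ _ _ _ (Nat.lt_of_not_le hlive)]⟩

/-- Every state of the orbit has the shape. [folklore] -/
theorem shape_iterate (x : List Bool) (t : ℕ) : Shape D p x ((roundM D p)^[t] (initM D p x)) := by
  induction t with
  | zero => exact shape_initM D p x
  | succ t ih => rw [Function.iterate_succ_apply']; exact shape_roundM D p ih

/-- **The space polynomial** of the majority decider. [folklore] -/
def sM : Polynomial ℕ := 2 * X + 4 * p + 3 * D.s.comp (2 * X + 3 + p) + 15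

/-- **Size of the orbit.** [cite: Gill1977, Prop. 5.2(i) (proof: polynomial space)] -/
theorem length_iterate_le (x : List Bool) (t : ℕ) :
    ((roundM D p)^[t] (initM D p x)).length ≤ (sM D p).eval x.length := by
  obtain ⟨a, i, r, hi, hr, h⟩ := shape_iterate D p x t
  rw [h, length_mk, sM]
  have hy : (cand (2 ^ p.eval x.length - 1 + i)).length ≤ p.eval x.length + 1 := length_cand_block_le hi
  have hxy : (boolPair x (cand (2 ^ p.eval x.length - 1 + i))).length ≤ 2 * x.length + 3 + p.eval x.length := by
    rw [length_boolPair]; omega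
  have h1 : (D.F^[r] (D.ι (boolPair x (cand (2 ^ p.eval x.length - 1 + i))))).length ≤
      D.s.eval (2 * x.length + 3 + p.eval x.length) :=
    (D.size_le _ r).trans (TM2Iter.eval_mono D.s hxy)
  have h2 : N D x (cand (2 ^ p.eval x.length - 1 + i)) ≤ D.s.eval (2 * x.length + 3 + p.eval x.length) :=
    (D.Nu_le _).trans (TM2Iter.eval_mono D.s hxy)
  have h3 : (encodeNat r).length ≤ N D x (cand (2 ^ p.eval x.length - 1 + i)) + 1 := by
    rw [TM2Pass.length_encodeNat_eq_size, Nat.size_le]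
    calc r ≤ 2 ^ N D x _ := hr
      _ < 2 ^ (N D x _ + 1) := Nat.pow_lt_pow_right (by norm_num) (Nat.lt_succ_self _)
  have h4 := PPEnum.length_counter_le A p x hi
  simp only [eval_add, eval_mul, eval_ofNat, eval_X, eval_comp]
  omega

end Round

end Majority

open Majority

/-- **G3. Orbit deciders are closed under the majority quantifier**: from an orbit decider of `A` and a
polynomial `p`, an orbit decider of `{x | 2^{p(|x|)} < 2 · #{y ∈ {0,1}^{p(|x|)} | ⟨x, y⟩ ∈ A}}` —
enumerate the coin strings of length `p(|x|)`, for each restart the inner orbit and run it for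
`2^{|Nu ⟨x,y⟩|}` rounds, count the verdicts on top of `2^{p(|x|)-1} - 1` and read the majority off the
length of the count. [cite: Gill1977, Prop. 5.2(i) (PP ⊆ PSPACE: enumerate the coin sequences in the space of one simulation and count)] -/
def pMajority (D : OrbitDecider A) (p : Polynomial ℕ) :
    OrbitDecider {x | 2 ^ p.eval x.length < 2 * cnt (p.eval x.length) {y : List Bool | boolPair x y ∈ A}} where
  F := roundM D p
  F_mem := roundM_mem_FP D p
  ι := initM D p
  ι_mem := initM_mem_FP D p
  Nu := NuM D p
  Nu_mem := NuM_mem_FP D p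
  s := sM D p
  Nu_le x := by
    rw [NuM, Plumb.polyFn_apply, ones, List.length_replicate, sM]
    simp only [eval_add, eval_mul, eval_ofNat, eval_X, eval_comp]
    have := TM2Iter.eval_mono D.s
      (show 2 * x.length + 2 + p.eval x.length ≤ 2 * x.length + 3 + p.eval x.length by omega)
    omega
  size_le := length_iterate_le D p
  correct x := by
    have hT : S D p x (2 ^ p.eval x.length) ≤ 2 ^ (NuM D p x).length := by
      rw [NuM, Plumb.polyFn_apply, ones, List.length_replicate]
      simpa [eval_add, eval_comp, eval_mul] using S_last_le D p x
    obtain ⟨d, hd⟩ := Nat.exists_eq_add_of_le hT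
    rw [hd, Nat.add_comm, Function.iterate_add_apply, iterate_roundM_S D p x le_rfl, iterate_roundM_frozen,
      headI_mk, PPEnum.ansBit_two_pow, decide_eq_true_iff]
    rfl

end OrbitDecider

/-! ### `C'·PSPACE ⊆ PSPACE` -/

/-- **The majority quantifier of an orbit-decided language is in `PSPACE`.** [cite: Gill1977, Prop. 5.2(i) (proof)] [cite: AroraBarakCC2009, Thm. 4.2 and §4.1 (reuse of space)] -/
theorem mem_PSPACE_pMajority_of_orbitDecider {A : Language Bool} (D : OrbitDecider A) (p : Polynomial ℕ) :
    {x | 2 ^ p.eval x.length < 2 * cnt (p.eval x.length) {y : List Bool | boolPair x y ∈ A}} ∈ PSPACE :=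
  (D.pMajority p).mem_PSPACE

/-- **`C'·PSPACE ⊆ PSPACE`**: the majority operator `pMajority` does not lead out of `PSPACE` — the
witness language `L' ∈ PSPACE` has an orbit decider (`orbitDecider_of_mem_PSPACE`), orbit deciders are
closed under the majority quantifier (`OrbitDecider.pMajority`), and `x ∈ L` iff
`2^{p(|x|)} < 2 · cnt` (`half_lt_uniformProb_iff`). This is the induction step of `CH ⊆ PSPACE`
(Bürgisser, ECCC TR06-113, §2.1, p. 5) and the relativisation of Gill's `PP ⊆ PSPACE`.
[cite: Burgisser2006, §2.1 (p. 5: CH ⊆ PSPACE)] [cite: Gill1977, Prop. 5.2(i)] -/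
theorem pMajority_PSPACE_subset_PSPACE : pMajority PSPACE ⊆ PSPACE := by
  rintro L ⟨L', hL', p, hp⟩
  have hL : L = {x | 2 ^ p.eval x.length < 2 * cnt (p.eval x.length) {y : List Bool | boolPair x y ∈ L'}} :=
    Set.ext fun x => (hp x).trans (half_lt_uniformProb_iff _ _)
  rw [hL]
  exact mem_PSPACE_pMajority_of_orbitDecider (orbitDecider_of_mem_PSPACE hL') p

/-- **`C'·PSPACE = PSPACE`** (the other inclusion ignores the coins: `PSPACE` is closed under the
first projection, `OrbitDecider.preimage` along `fstP`, and then every coin string votes `[x ∈ L]`).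
[cite: Burgisser2006, §2.1 and Remark 2.2 (K ⊆ C·K)] -/
theorem pMajority_PSPACE_eq : pMajority PSPACE = PSPACE := by
  refine Set.Subset.antisymm pMajority_PSPACE_subset_PSPACE fun L hL => ?_
  set L' : Language Bool := {w | fstP w ∈ L} with hL'
  refine ⟨L', ((orbitDecider_of_mem_PSPACE hL).preimage fstP_mem_FP).mem_PSPACE, 0, fun x => ?_⟩
  have hmem : ∀ y : List Bool, boolPair x y ∈ L' ↔ x ∈ L := fun y => by
    change fstP (boolPair x y) ∈ L ↔ x ∈ L
    rw [fstP_boolPair]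
  by_cases hx : x ∈ L
  · have hset : {y : List Bool | boolPair x y ∈ L'} = Set.univ :=
      Set.eq_univ_of_forall fun y => (hmem y).2 hx
    rw [hset, uniformProb_univ]
    simp only [hx, true_iff]
    norm_num
  · have hset : {y : List Bool | boolPair x y ∈ L'} = ∅ :=
      Set.eq_empty_of_forall_notMem fun y hy => hx ((hmem y).1 hy)
    rw [hset, uniformProb_empty]
    simp only [hx, false_iff, not_lt]
    norm_num

/-! ### `CₖP ⊆ PSPACE`, `CH ⊆ PSPACE` -/

/-- **Every level of the counting hierarchy is in `PSPACE`**: `C₀P = P ⊆ PSPACE`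
(`P_subset_PSPACE_holds`) and `Cₖ₊₁P = C'·CₖP ⊆ C'·PSPACE ⊆ PSPACE` (`pMajority_mono`,
`pMajority_PSPACE_subset_PSPACE`). [cite: Burgisser2006, §2.1 (p. 5: CH ⊆ PSPACE)] -/
theorem CkP_subset_PSPACE : ∀ k : ℕ, CkP k ⊆ PSPACE
  | 0 => P_subset_PSPACE_holds
  | k + 1 => (pMajority_mono (CkP_subset_PSPACE k)).trans pMajority_PSPACE_subset_PSPACE

/-- **`CH ⊆ PSPACE`** — discharge of the named fact `CH_subset_PSPACE` (`CountingHierarchy.lean`):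
a language of `CH` lies in some level `CₖP ⊆ PSPACE` (`CkP_subset_PSPACE`). Bürgisser, ECCC TR06-113,
§2.1, p. 5: "it is not hard to see that CH is contained in the class PSPACE of languages decidable in
polynomial space" (Wagner 1986); the proof formalised here is the level-by-level enumeration of the coin
strings in the space of one decision (Gill 1977, Prop. 5.2(i), relativised to an orbit decider).
[cite: Burgisser2006, §2.1 (p. 5: CH ⊆ PSPACE)] -/
theorem CH_subset_PSPACE_holds : CH_subset_PSPACE := by
  intro L hL
  obtain ⟨k, hk⟩ := mem_CH_iff.1 hL
  exact CkP_subset_PSPACE k hk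

/-- `PP = C₁P ⊆ PSPACE` through the counting hierarchy (Gill 1977, Prop. 5.2(i); the tree's direct proof
is `PPEnum.pMajority_P_subset_PSPACE`). [cite: Gill1977, Prop. 5.2(i) (PP ⊆ PSPACE)] -/
theorem PP_subset_PSPACE_of_CH : PP ⊆ PSPACE :=
  PP_subset_CH.trans CH_subset_PSPACE_holds

end Literature.Computability.Complexity

end
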